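import Summits.ValiantsHypothesis.ValiantsHypothesis.Theorems.KPlusLogSqLawTropicalBThreeFiveKit3

/-!
# Route «KPlusLogSqLaw», crux `TropicalB` (stmt-ValiantsHypothesis-19771) — certificate kit for the `(3,5)` row, part 4:
# the combined refutation search `search3` (pairwise + three-term laws), its soundness, first-term row relabelling, and the
# COVERING LEMMA «a family of refuted patterns avoided by every pair of histograms ⇒ `n ≤ 31`»

HONEST FRAMING.  Helper toward the registered stubs `stub_tropThin` / `stub_tropFat` of `Cruxes/TropicalB/Lines/birth.lean` (crux `TropicalB`,
item stmt-ValiantsHypothesis-19771; cell `pub-symmetroid`, seat val-sym-trop-p3 g10, 2026-08-28; `--supports … --as helper`).  Generic MACHINERY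
ONLY (sequel of `…ThreeFiveKit3`) — no census value is claimed here; the first application is `…ThreeFiveExact04112130` (one exponent vector).
Nothing here bears on `TropicalB` in its window, `WeakLifting`, DoorA26 / DoorA34, `MatrixDescartes` (stmt-ValiantsHypothesis-18050) or VP ≠ VNP.

CONTENT.
* `anyPair`, `search3 R2 R3 R6 asg rest` — val-sym-trop-p4 g5's depth-first pattern refutation (`ThreeFive.search`) with BOTH order-level tests:
  the new term against every placed term (`domO`) and against every ordered pair of placed terms (`domO3`); `search3_sound` (placed terms in time
  order).
* `search31` — first pattern position restricted to the identity permutation; `false_of_search31` — a refuted pattern whose histograms all occur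
  on a chain with strictly increasing slopes is contradictory (rows relabelled by the first term's permutation, `isDominant_relabel_iff`).
* `exists_two_missing` — an unsigned chain with `n ≥ 32` carries every histogram but at most two.
* `Entry`, `leD_31_of_family` — if each entry (own relation lists + pattern) is refuted by `search31`, the relations hold for the monotone `d`, the
  patterns are slope-ordered, and every PAIR of histograms is avoided by some pattern, then `n ≤ 31` for every unsigned dominant chain of a `(3,5)`
  design with exponents `d`.
[this cell; the laws are the tree's (`sum_d_lt_of_isDominant_invariant`, `MultiExchange.prefix_deficit`), the packaging follows val-sym-trop-p4 g5]
-/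

set_option linter.dupNamespace false
set_option autoImplicit false

namespace Summit.ValiantsHypothesis.ValiantsHypothesis.Theorems.KPlusLogSqLaw

open Summit.ValiantsHypothesis.ValiantsHypothesis.Theorems.MatrixDescartes.Negative
open Summit.ValiantsHypothesis.ValiantsHypothesis.Theorems.LacunarySymmetroidMatrixDescartes.TropicalCensus
open Finset ForbiddenPatterns

namespace ThreeFive

/-! ## 3. The combined refutation search `search3` and its soundness -/

/-- some ORDERED pair of a list (earlier element first) passes `f`. -/
def anyPair (f : AT → AT → Bool) : List AT → Bool
  | [] => false
  | a :: l => (l.any fun b => f a b) || anyPair f l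

/-- what `anyPair` on a mapped list gives back on the original list, together with a pairwise relation of the original list. -/
theorem exists_of_anyPair_map {α : Type*} (f : AT → AT → Bool) (g : α → AT) (R : α → α → Prop) :
    ∀ l : List α, anyPair f (l.map g) = true → l.Pairwise R → ∃ a ∈ l, ∃ b ∈ l, R a b ∧ f (g a) (g b) = true
  | [], h, _ => by simp [anyPair] at h
  | a :: l, h, hR => by
      simp only [List.map_cons, anyPair, Bool.or_eq_true, List.any_eq_true, List.mem_map] at h
      rcases h with ⟨_, ⟨b, hb, rfl⟩, hf⟩ | h
      · exact ⟨a, List.mem_cons_self, b, List.mem_cons_of_mem _ hb, List.rel_of_pairwise_cons hR hb, hf⟩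
      · obtain ⟨a', ha', b', hb', hab, hf⟩ := exists_of_anyPair_map f g R l h hR.of_cons
        exact ⟨a', List.mem_cons_of_mem _ ha', b', List.mem_cons_of_mem _ hb', hab, hf⟩

/-- **depth-first refutation with both laws.**  `search3 R2 R3 R6 asg rest = true` iff EVERY way of realising the histograms of `rest` in
order (any permutation vector, any listed class arrangement), after the placed abstract terms `asg` (in time order), contains a pair
(earlier, later) passing `domO` or a triple (earlier, middle, later) passing `domO3`. -/
def search3 (R2 : Rel2) (R3 : Rel3) (R6 : Rel6) : List AT → List (List (Fin 3 → Fin 5)) → Bool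
  | _, [] => false
  | asg, arrs :: rest => arrs.all fun c => S3V.all fun σ =>
      (asg.any fun a => domO R2 R3 a (σ, c)) || anyPair (fun a b => domO3 R3 R6 a b (σ, c)) asg ||
        search3 R2 R3 R6 (asg ++ [(σ, c)]) rest

section Sound

variable (d : Fin 5 → ℕ) (v ε : Fin 3 → Fin 3 → Fin 5 → ℤ) (R2 : Rel2) (R3 : Rel3) (R6 : Rel6)

/-- **soundness of `search3`**: a refuted pattern is realised by no increasing family of unique optima placed after the (time-ordered)
terms `asg`. -/
theorem search3_sound (hmono : Monotone d)
    (hR2 : ∀ r ∈ R2, d r.1.1 + d r.1.2 < d r.2.1 + d r.2.2)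
    (hR3 : ∀ r ∈ R3, d r.1.1 + d r.1.2.1 + d r.1.2.2 < d r.2.1 + d r.2.2.1 + d r.2.2.2)
    (hR6 : ∀ r ∈ R6, s3 d r.1.1 + s3 d r.1.2 < s3 d r.2.1 + s3 d r.2.2) :
    ∀ (rest : List (List (Fin 3 → Fin 5))) (asg fut : List (ℤ × (Equiv.Perm (Fin 3) × (Fin 3 → Fin 5)))),
      search3 R2 R3 R6 (asg.map fun a => abs a.2) rest = true →
      List.Forall₂ (fun f arrs => f.2.2 ∈ arrs) fut rest →
      (∀ a ∈ asg, IsDominant d v ε a.1 a.2) → (∀ f ∈ fut, IsDominant d v ε f.1 f.2) →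
      (∀ a ∈ asg, ∀ f ∈ fut, a.1 < f.1) → asg.Pairwise (fun a b => a.1 < b.1) → fut.Pairwise (fun f g => f.1 < g.1) → False := by
  intro rest
  induction rest with
  | nil =>
    intro asg fut hs
    simp [search3] at hs
  | cons arrs rest ih =>
    intro asg fut hs hF hasg hfut hlt hpa hpw
    cases hF with
    | cons hmem hrest =>
      rename_i f fut'
      simp only [search3, List.all_eq_true, Bool.or_eq_true, List.any_eq_true] at hs
      rcases hs f.2.2 hmem (⇑f.2.1) (mem_S3V _) with (⟨a, ha, hdom⟩ | htri) | hs'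
      · obtain ⟨a', ha', rfl⟩ := List.mem_map.mp ha
        exact domO_sound d v ε R2 R3 hmono hR2 hR3 (hlt a' ha' f (List.mem_cons_self)) a'.2 f.2
          (hasg a' ha') (hfut f (List.mem_cons_self)) hdom
      · obtain ⟨a', ha', b', hb', hab, hf⟩ :=
          exists_of_anyPair_map (fun a b => domO3 R3 R6 a b (⇑f.2.1, f.2.2)) (fun a => abs a.2) (fun a b => a.1 < b.1) asg htri hpa
        exact domO3_sound d v ε R3 R6 hmono hR3 hR6 hab (hlt b' hb' f (List.mem_cons_self)) a'.2 b'.2 f.2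
          (hasg a' ha') (hasg b' hb') (hfut f (List.mem_cons_self)) hf
      · refine ih (asg ++ [f]) fut' ?_ hrest ?_ ?_ ?_ ?_ ?_
        · simpa [List.map_append, abs] using hs'
        · intro a ha
          rcases List.mem_append.mp ha with ha | ha
          · exact hasg a ha
          · rw [List.mem_singleton] at ha
            subst ha
            exact hfut _ (List.mem_cons_self)
        · exact fun g hg => hfut g (List.mem_cons_of_mem _ hg)
        · intro a ha g hg
          rcases List.mem_append.mp ha with ha | ha
          · exact hlt a ha g (List.mem_cons_of_mem _ hg)
          · rw [List.mem_singleton] at ha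
            subst ha
            exact List.rel_of_pairwise_cons hpw hg
        · rw [List.pairwise_append]
          refine ⟨hpa, List.pairwise_singleton _ _, fun a ha b hb => ?_⟩
          rw [List.mem_singleton] at hb
          subst hb
          exact hlt a ha _ (List.mem_cons_self)
        · exact hpw.of_cons

end Sound

/-! ## 4. First-term row relabelling and the refutation of a located pattern -/

/-- the combined search with the FIRST pattern position restricted to the identity permutation (rows relabelled). -/
def search31 (R2 : Rel2) (R3 : Rel3) (R6 : Rel6) : List (List (Fin 3 → Fin 5)) → Bool
  | [] => false
  | arrs :: rest => arrs.all fun c => search3 R2 R3 R6 [(![0, 1, 2], c)] rest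

section Refute

variable (d : Fin 5 → ℕ) (v ε : Fin 3 → Fin 3 → Fin 5 → ℤ) (R2 : Rel2) (R3 : Rel3) (R6 : Rel6)

/-- **a pattern refuted by `search31` is carried by no unsigned dominant chain**: if every histogram of the pattern occurs at some position of a
chain whose slopes strictly increase (positions `pos`), the pattern is slope-ordered by `d` and the relations hold, contradiction. -/
theorem false_of_search31 (hmono : Monotone d)
    (hR2 : ∀ r ∈ R2, d r.1.1 + d r.1.2 < d r.2.1 + d r.2.2)
    (hR3 : ∀ r ∈ R3, d r.1.1 + d r.1.2.1 + d r.1.2.2 < d r.2.1 + d r.2.2.1 + d r.2.2.2)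
    (hR6 : ∀ r ∈ R6, s3 d r.1.1 + s3 d r.1.2 < s3 d r.2.1 + s3 d r.2.2)
    (pat : List (Sym (Fin 5) 3 × List (Fin 3 → Fin 5)))
    (hsearch : search31 R2 R3 R6 (pat.map Prod.snd) = true)
    (harr : ∀ q ∈ pat, ∀ c : Fin 3 → Fin 5, (univ.val.map c : Multiset (Fin 5)) = (q.1 : Multiset (Fin 5)) → c ∈ q.2)
    (hord : pat.IsChain (fun q q' => symSlope d q.1 < symSlope d q'.1))
    {n : ℕ} (θ : Fin (n + 1) → ℤ) (p : Fin (n + 1) → Equiv.Perm (Fin 3) × (Fin 3 → Fin 5)) (hθ : StrictMono θ)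
    (hdom : ∀ k, IsDominant d v ε (θ k) (p k)) (hsm : StrictMono fun k => slope d (p k))
    (pos : Sym (Fin 5) 3 × List (Fin 3 → Fin 5) → Fin (n + 1)) (hpos : ∀ q ∈ pat, classSym (p (pos q)) = q.1) : False := by
  classical
  obtain ⟨q₀, pat', rfl⟩ : ∃ q₀ pat', pat = q₀ :: pat' := by
    cases pat with
    | nil => simp [search31] at hsearch
    | cons q₀ pat' => exact ⟨q₀, pat', rfl⟩
  -- relabel the rows by the permutation of the first pattern term
  set π : Equiv.Perm (Fin 3) := (p (pos q₀)).1 with hπ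
  let v' : Fin 3 → Fin 3 → Fin 5 → ℤ := fun a b l => v (π a) b l
  let ε' : Fin 3 → Fin 3 → Fin 5 → ℤ := fun a b l => ε (π a) b l
  let p' : Fin (n + 1) → Equiv.Perm (Fin 3) × (Fin 3 → Fin 5) := fun k => (π⁻¹ * (p k).1, (p k).2)
  have hdom' : ∀ k, IsDominant d v' ε' (θ k) (p' k) := by
    intro k
    have h := (isDominant_relabel_iff d v ε π 1 (π⁻¹ * (p k).1, (p k).2) (θ k)).mp
    have e : ((π * (π⁻¹ * (p k).1) * (1 : Equiv.Perm (Fin 3))⁻¹ : Equiv.Perm (Fin 3)),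
        fun j => (p k).2 (((1 : Equiv.Perm (Fin 3))⁻¹) j)) = p k := by
      ext1
      · ext1 x; simp
      · funext j; simp
    rw [e] at h
    simpa [v', ε'] using h (hdom k)
  let fut : List (ℤ × (Equiv.Perm (Fin 3) × (Fin 3 → Fin 5))) := pat'.map fun q => (θ (pos q), p' (pos q))
  let f₀ : ℤ × (Equiv.Perm (Fin 3) × (Fin 3 → Fin 5)) := (θ (pos q₀), p' (pos q₀))
  have hs1 : search3 R2 R3 R6 [(![0, 1, 2], (p (pos q₀)).2)] (pat'.map Prod.snd) = true := by
    simp only [search31, List.map_cons, List.all_eq_true] at hsearch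
    refine hsearch _ (harr q₀ (List.mem_cons_self) _ ?_)
    have := congrArg (fun s : Sym (Fin 5) 3 => (s : Multiset (Fin 5))) (hpos q₀ (List.mem_cons_self))
    simpa [classSym] using this
  have habs : [(![0, 1, 2], (p (pos q₀)).2)] = [f₀].map fun a => abs a.2 := by
    simp only [List.map_cons, List.map_nil, abs, f₀, p']
    rw [hπ, inv_mul_cancel, coe_one_eq]
  rw [habs] at hs1
  have hθlt : ∀ q ∈ q₀ :: pat', ∀ q' ∈ q₀ :: pat', symSlope d q.1 < symSlope d q'.1 → θ (pos q) < θ (pos q') := by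
    intro q hq q' hq' h
    apply hθ
    apply hsm.lt_iff_lt.mp
    show slope d (p (pos q)) < slope d (p (pos q'))
    rw [slope_eq_symSlope, slope_eq_symSlope, hpos q hq, hpos q' hq']
    exact h
  haveI : Trans (fun q q' : Sym (Fin 5) 3 × List (Fin 3 → Fin 5) => symSlope d q.1 < symSlope d q'.1)
      (fun q q' : Sym (Fin 5) 3 × List (Fin 3 → Fin 5) => symSlope d q.1 < symSlope d q'.1)
      (fun q q' : Sym (Fin 5) 3 × List (Fin 3 → Fin 5) => symSlope d q.1 < symSlope d q'.1) :=
    ⟨fun h1 h2 => lt_trans h1 h2⟩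
  have hpwS : (q₀ :: pat').Pairwise (fun q q' => symSlope d q.1 < symSlope d q'.1) := hord.pairwise
  have hpw : (q₀ :: pat').Pairwise (fun q q' => θ (pos q) < θ (pos q')) :=
    hpwS.imp_of_mem fun ha hb h => hθlt _ ha _ hb h
  refine search3_sound d v' ε' R2 R3 R6 hmono hR2 hR3 hR6 (pat'.map Prod.snd) [f₀] fut hs1 ?_ ?_ ?_ ?_ (List.pairwise_singleton _ _) ?_
  · refine forall₂_map_map _ _ _ pat' fun q hq => harr q (List.mem_cons_of_mem _ hq) _ ?_
    have := congrArg (fun s : Sym (Fin 5) 3 => (s : Multiset (Fin 5))) (hpos q (List.mem_cons_of_mem _ hq))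
    simpa [classSym] using this
  · intro a ha
    rw [List.mem_singleton] at ha
    subst ha
    exact hdom' _
  · intro f hf
    obtain ⟨q, -, rfl⟩ := List.mem_map.mp hf
    exact hdom' _
  · intro a ha f hf
    rw [List.mem_singleton] at ha
    subst ha
    obtain ⟨q, hq, rfl⟩ := List.mem_map.mp hf
    exact List.rel_of_pairwise_cons hpw hq
  · exact List.pairwise_map.mpr hpw.of_cons

/-! ## 5. At most two histograms are missing from a 33-term chain; the covering lemma -/

/-- an unsigned chain of a `(3,5)` design with `n ≥ 32` (at least 33 terms) carries every histogram except at most two. -/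
theorem exists_two_missing {d : Fin 5 → ℕ} {v ε : Fin 3 → Fin 3 → Fin 5 → ℤ} {n : ℕ} {θ : Fin (n + 1) → ℤ}
    {p : Fin (n + 1) → Equiv.Perm (Fin 3) × (Fin 3 → Fin 5)} (hθ : StrictMono θ)
    (hdom : ∀ k, IsDominant d v ε (θ k) (p k)) (hne : ∀ k : Fin n, p k.castSucc ≠ p k.succ) (hn : 32 ≤ n) :
    (StrictMono fun k => slope d (p k)) ∧
      ∃ x y : Sym (Fin 5) 3, ∀ s : Sym (Fin 5) 3, s ≠ x → s ≠ y → ∃ k, classSym (p k) = s := by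
  classical
  have hsm : StrictMono fun k => slope d (p k) := by
    rw [Fin.strictMono_iff_lt_succ]
    intro k
    exact slope_lt_of_dominant d v ε (hθ Fin.castSucc_lt_succ) (hne k) (hdom _) (hdom _)
  have hinj : Function.Injective fun k => classSym (p k) := by
    intro k k' h
    apply hsm.injective
    simp only
    rw [slope_eq_of_classSym, slope_eq_of_classSym]
    exact congrArg (fun M : Sym (Fin 5) 3 => ((M : Multiset (Fin 5)).map fun l => (d l : ℤ)).sum) h
  refine ⟨hsm, ?_⟩
  set S : Finset (Sym (Fin 5) 3) := univ.image fun k => classSym (p k) with hS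
  have hcardS : S.card = n + 1 := by
    rw [hS, card_image_of_injective _ hinj, card_univ, Fintype.card_fin]
  have hcard : Fintype.card (Sym (Fin 5) 3) = 35 := by
    rw [Sym.card_sym_eq_multichoose, Fintype.card_fin, Nat.multichoose_eq]
    decide
  have hcompl : Sᶜ.card ≤ 2 := by
    rw [card_compl, hcard, hcardS]
    omega
  have hmemS : ∀ s, s ∈ S ↔ ∃ k, classSym (p k) = s := fun s => by simp [hS]
  -- pick the (at most two) missing histograms
  obtain ⟨l, hl, hlen⟩ : ∃ l : List (Sym (Fin 5) 3), (∀ s, s ∉ S → s ∈ l) ∧ l.length ≤ 2 :=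
    ⟨Sᶜ.toList, fun s hs => by simpa using hs, by rw [length_toList]; exact hcompl⟩
  match l, hl, hlen with
  | [], hl, _ =>
    refine ⟨classSym (p 0), classSym (p 0), fun s _ _ => ?_⟩
    by_contra hs
    exact absurd (hl s (fun h => hs ((hmemS s).mp h))) (by simp)
  | [x], hl, _ =>
    refine ⟨x, x, fun s hx _ => ?_⟩
    by_contra hs
    have := hl s (fun h => hs ((hmemS s).mp h))
    simp only [List.mem_singleton] at this
    exact hx this
  | [x, y], hl, _ =>
    refine ⟨x, y, fun s hx hy => ?_⟩
    by_contra hs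
    have := hl s (fun h => hs ((hmemS s).mp h))
    simp only [List.mem_cons, List.not_mem_nil, or_false] at this
    rcases this with h | h
    · exact hx h
    · exact hy h
  | _ :: _ :: _ :: _, _, hlen => simp at hlen

/-- a CERTIFICATE ENTRY: relation lists `(R2, R3, R6)` and a pattern (histograms with arrangement lists), refuted by `search31`. -/
abbrev Entry := Rel2 × Rel3 × Rel6 × List (Sym (Fin 5) 3 × List (Fin 3 → Fin 5))

/-- **COVERING LEMMA — `n ≤ 31` from a family of refuted patterns avoided by every pair of histograms.**  If every entry of `F` is refuted
by `search31` under ITS OWN relation lists, all true for the monotone `d`, its pattern slope-ordered by `d`, and for every two histograms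
`x, y` some entry's pattern contains neither, then every unsigned dominant chain of a `(3,5)` design with exponents `d` has at most `31`
breakpoints (a 33-term chain misses at most two histograms, so it carries a whole pattern). -/
theorem leD_31_of_family (F : List Entry)
    (hsearch : ∀ e ∈ F, search31 e.1 e.2.1 e.2.2.1 (e.2.2.2.map Prod.snd) = true)
    (harr : ∀ e ∈ F, ∀ q ∈ e.2.2.2, ∀ c : Fin 3 → Fin 5, (univ.val.map c : Multiset (Fin 5)) = (q.1 : Multiset (Fin 5)) → c ∈ q.2)
    (hcover : ∀ x y : Sym (Fin 5) 3, ∃ e ∈ F, ∀ q ∈ e.2.2.2, q.1 ≠ x ∧ q.1 ≠ y)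
    (hmono : Monotone d)
    (hR2 : ∀ e ∈ F, ∀ r ∈ e.1, d r.1.1 + d r.1.2 < d r.2.1 + d r.2.2)
    (hR3 : ∀ e ∈ F, ∀ r ∈ e.2.1, d r.1.1 + d r.1.2.1 + d r.1.2.2 < d r.2.1 + d r.2.2.1 + d r.2.2.2)
    (hR6 : ∀ e ∈ F, ∀ r ∈ e.2.2.1, s3 d r.1.1 + s3 d r.1.2 < s3 d r.2.1 + s3 d r.2.2)
    (hord : ∀ e ∈ F, e.2.2.2.IsChain (fun q q' => symSlope d q.1 < symSlope d q'.1))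
    (n : ℕ) (θ : Fin (n + 1) → ℤ) (p : Fin (n + 1) → Equiv.Perm (Fin 3) × (Fin 3 → Fin 5)) (hθ : StrictMono θ)
    (hdom : ∀ k, IsDominant d v ε (θ k) (p k)) (hne : ∀ k : Fin n, p k.castSucc ≠ p k.succ) : n ≤ 31 := by
  classical
  by_contra hn
  push Not at hn
  obtain ⟨hsm, x, y, hxy⟩ := exists_two_missing hθ hdom hne (by omega)
  obtain ⟨e, he, havoid⟩ := hcover x y
  have hposq : ∀ q ∈ e.2.2.2, ∃ k, classSym (p k) = q.1 := fun q hq => hxy q.1 (havoid q hq).1 (havoid q hq).2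
  let pos : Sym (Fin 5) 3 × List (Fin 3 → Fin 5) → Fin (n + 1) := fun q =>
    if h : ∃ k, classSym (p k) = q.1 then Classical.choose h else 0
  have hpos : ∀ q ∈ e.2.2.2, classSym (p (pos q)) = q.1 := by
    intro q hq
    simp only [pos, dif_pos (hposq q hq)]
    exact Classical.choose_spec (hposq q hq)
  exact false_of_search31 d v ε e.1 e.2.1 e.2.2.1 hmono (hR2 e he) (hR3 e he) (hR6 e he) e.2.2.2 (hsearch e he) (harr e he)
    (hord e he) θ p hθ hdom hsm pos hpos

end Refute

end ThreeFive

end Summit.ValiantsHypothesis.ValiantsHypothesis.Theorems.KPlusLogSqLaw
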